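import Summits.Ventures.PercRepro.ProfilePointedCircuitClassesFourteenQuad2

/-!
# PercRepro — THE q = 7 ROW AT `n = 14` WHEN EVERY `9`-SUBSET HAS RANK `≥ 7` (p5, gen 43; `proofs/P5-GM1.md` §65(o))

The sparse regime of the twelve-point statement (ProfilePointedCircuitClassesTwelveSparse: every `8`-subset of the
`12`-point matroid has rank `≥ 6`) lifts to the row `(14, 8)` exactly as the second quad regime did
(ProfilePointedCircuitClassesFourteenQuad2): an `8`-subset `X` of the minor `N ／ x ∖ w` has
`ρ°(X) = ρ_N(X + x) − 1`, and `X + x` is a `9`-subset of `E`.  So if EVERY `9`-SUBSET OF `E` HAS RANK `≥ 7`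
(`sparse_minor`), every minor satisfies the sparse hypothesis, and with §64's per-pair theorem on the minors the
minor-quantified chain gives **`thresholdIneq_seven_top_of_fourteen_of_sparse : ThresholdIneq N 7 7`** and
`biIndep_step_six_of_fourteen_of_sparse` (`8·P_6 ≤ 7·P_7`) on every matroid with `14` points and rank `8` whose
`9`-subsets all have rank `≥ 7`.
-/

open scoped Matroid

namespace PercRepro.Cogirth

open Finset ThmH Skew Shadow Profile

variable {α : Type} [DecidableEq α] {N : Matroid α} [N.Finite]

section FourteenSparse

/-- **THE SPARSE HYPOTHESIS PASSES TO THE MINORS**: if every `9`-subset of `E` has rank `≥ 7`, every `8`-subset of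
the minor `N ／ x ∖ w` (`x ∈ E` a non-loop) has rank `≥ 6` in the minor. -/
theorem sparse_minor (h9 : ∀ Y ⊆ gr N, Y.card = 9 → 7 ≤ rk N Y) {x w : α} (hxg : x ∈ gr N)
    (hx1 : rk N {x} = 1) :
    ∀ X ⊆ gr ((N ／ ({x} : Set α)) ＼ ({w} : Set α)), X.card = 8 →
      6 ≤ rk ((N ／ ({x} : Set α)) ＼ ({w} : Set α)) X := by
  intro X hX hX8
  have h := rk_minor_add_one (w := w) hx1 hX
  have hgr : gr ((N ／ ({x} : Set α)) ＼ ({w} : Set α)) = ((gr N).erase x).erase w := by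
    rw [gr_delete', gr_contract']
  rw [hgr] at hX
  have hxX : x ∉ X := fun hx => (mem_erase.1 (mem_of_mem_erase (hX hx))).1 rfl
  have h9' := h9 (insert x X) (insert_subset hxg (hX.trans ((erase_subset _ _).trans (erase_subset _ _))))
    (by rw [card_insert_of_notMem hxX, hX8])
  omega

/-- The minors' per-point inequality on `14` points when every `9`-subset has rank `≥ 7`. -/
theorem inOutMinors_of_sparse (hn : (gr N).card = 14) (h9 : ∀ Y ⊆ gr N, Y.card = 9 → 7 ≤ rk N Y) :
    InOutMinors N := by
  intro x w e hxg hwg hxw hx1 _ _ _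
  have hgr : gr ((N ／ ({x} : Set α)) ＼ ({w} : Set α)) = ((gr N).erase x).erase w := by
    rw [gr_delete', gr_contract']
  have hcard : (gr ((N ／ ({x} : Set α)) ＼ ({w} : Set α))).card = 12 := by
    rw [hgr, card_erase_of_mem (mem_erase.2 ⟨hxw.symm, hwg⟩), card_erase_of_mem hxg, hn]
  exact inCount_five_le_outCount_six_of_twelve_of_sparse hcard (sparse_minor h9 hxg hx1) e

/-- **THEOREM A'S STEP AT THE LEVEL `6` ON `14` POINTS OF RANK `8` WHEN EVERY `9`-SUBSET HAS RANK `≥ 7`**: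
`8·P_6 ≤ 7·P_7`. -/
theorem biIndep_step_six_of_fourteen_of_sparse (hn : (gr N).card = 14) (hR : rk N (gr N) = 8)
    (h9 : ∀ Y ⊆ gr N, Y.card = 9 → 7 ≤ rk N Y) : 8 * (biIndepSets N 6).card ≤ 7 * (biIndepSets N 7).card := by
  have h := biIndep_step_six_of_nullity_six_of_minors (inOutMinors_of_sparse hn h9)
    (inOutPairMinors_of_fourteen hn) (by omega) (by omega)
  rw [hn] at h
  exact h

/-- **THE q = 7 ROW AT `n = 14` WHEN EVERY `9`-SUBSET HAS RANK `≥ 7`**: the co-rank-7 top threshold `(I_7)` on every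
matroid with `14` points and rank `8` whose `9`-subsets all have rank `≥ 7`. -/
theorem thresholdIneq_seven_top_of_fourteen_of_sparse (hn : (gr N).card = 14) (hR : rk N (gr N) = 8)
    (h9 : ∀ Y ⊆ gr N, Y.card = 9 → 7 ≤ rk N Y) : ThresholdIneq N 7 7 := by
  have h := thresholdIneq_seven_top_of_nullity_le_six_of_minors (inOutMinors_of_sparse hn h9)
    (inOutPairMinors_of_fourteen hn) (by omega) (by omega)
  rw [hR] at h
  exact h

end FourteenSparse

end PercRepro.Cogirth
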